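import Literature.AnabelianGeometry.SemiGraphs.FiniteEtaleCoveringLocalGlobalSection
import Literature.AnabelianGeometry.SemiGraphs.VertexAlignedStabilizers
import Literature.AnabelianGeometry.Anabelioids.ExactFunctorProofs

/-!
# Vertex alignment makes the local↔global section map a monomorphism
# ([SemiAnbd] Def. 2.2 (i) p. 23, Rem. 2.2.1 p. 24)

Mochizuki, *Semi-graphs of anabelioids*, Publ. RIMS **42** (2006) 221–322, §2: Def. 2.2 (i) p. 23 (the
finite étale covering `ℋ → 𝒦` attached to `A ∈ B(𝒦)`: GLOBALLY `B(ℋ) = B(𝒦)_{/A}`, LOCALLY `ℋ_w = (𝒦_u)_P`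
for a connected component `P` of `A_u`) and Rem. 2.2.1 p. 24 ("the image of each `Π_v` … in `Π_𝒢` is
equal to the stabilizer of a compatible system of vertices") [cite: MochizukiSemiAnbd2006, Rem. 2.2.1 p.24].

PROOF-ONLY companion (abc-iut cell, layer L3; FACT-LIST row F-1478 `remark_2_4_1_covering`, residual (L)
«print's finite étale coverings compose, local clause», sub-brick **(L-σ)** of abc-iut-w5-d041's
decomposition `HOME/staging/w5/w5-d041-g3/L-LOCAL-CLAUSE-DECOMPOSITION.md` §3/§6; seat abc-iut-w4-d079).
In the cell's covering notion the global witness (`αψ`, `e_ψ`) and the local witness at a vertex `w ↦ u`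
(`α_w`, `e_w`) are independent data; abc-iut-w5-d041's `Hom.localGlobalSection` is the SECTION MAP
`σ_w : P ⟶ A_u` of the comparison functor `K_w = αψ ⋙ ρ_w ⋙ α_w⁻¹` ("where the global witness places the
vertex `w`"), and the composite's local clause needs `σ_w` to be a MONOMORPHISM.  This file proves it from
VERTEX ALIGNMENT (`Hom.IsVertexAligned`, clause (a) `ι(Π_w) = Π′ ⊓ Π_u`):

* `Hom.map_localGlobalIso_hom_app_comp`, `Hom.map_section_comp` — unwinding `α_w` of the comparison
  isomorphism and of the section of `K_w` (triangle identity of the adjoint equivalence `α_w`);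
* `Hom.map_localGlobalSection_basePoint` — **`F(σ_w)` sends the LOCAL base point to the GLOBAL base point**
  (the two points of `range_pi1Map_eq_stabilizer′`, `DecompositionGroupGeneral` Part A, for `α_w, e_w`
  and for `αψ, e_ψ`), by naturality and the one-point fibres of the terminal objects;
* `Hom.IsVertexAligned.localGlobalSection_mono` — **`σ_w` is a monomorphism** for vertex-aligned `ψ` and
  `P ↪ A_u` connected: the group half `IsVertexAligned.mono_of_map_eq` (`VertexAlignedStabilizers`)
  applied at a basepoint `F′` of `ℋ_w`, `F := ψ_w^* ⋙ F′`.

No `def`, no new `Prop`; nothing here takes a side on [IUTchIII] Cor. 3.12.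
-/

namespace Literature.AnabelianGeometry.SemiGraphs

namespace SemiGraphOfAnabelioids

namespace Hom

open CategoryTheory CategoryTheory.Limits CategoryTheory.PreGaloisCategory
open Literature.AnabelianGeometry.Anabelioids

universe v₁ u₁ u

variable {ℋ 𝒦 : SemiGraphOfAnabelioids.{v₁, u₁, u}} (ψ : Hom ℋ 𝒦) (A : 𝒦.BObj)
  [HasBinaryProducts 𝒦.BObj] (αψ : Over A ⥤ ℋ.BObj) [αψ.IsEquivalence]
  (eψ : ψ.pullbackFunctor ≅ Over.star A ⋙ αψ) (w : ℋ.graph.Vertex)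
  (P : 𝒦.V (ψ.base.vertexMap w)) (αw : Over P ⥤ ℋ.V w) [αw.IsEquivalence]
  (ew : (ψ.φV w).pullback ≅ Over.star P ⋙ αw)

omit [HasBinaryProducts 𝒦.BObj] in
/-- The triangle identity `ε⁻¹_{α_w Z} ≫ α_w(η⁻¹_Z) = 𝟙` of the adjoint equivalence `α_w`, in
re-associated form. [cite: MochizukiSemiAnbd2006, Def. 2.2(i) p.23] -/
theorem counitInv_app_comp_map_unitInv_comp (Z : Over P) {X : ℋ.V w} (f : αw.obj Z ⟶ X) :
    αw.asEquivalence.counitIso.inv.app (αw.obj Z) ≫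
        αw.map (αw.asEquivalence.unitIso.inv.app Z) ≫ f = f := by
  rw [← Category.assoc]
  exact (congrArg (· ≫ f) (αw.asEquivalence.counitInv_functor_comp Z)).trans (Category.id_comp f)

omit [HasBinaryProducts 𝒦.BObj] in
/-- The re-typing constituent of `Hom.localGlobalIso` is an identity component
(`ψ^* ⋙ ρ_w = ρ_u ⋙ ψ_w^*` holds definitionally). [cite: MochizukiSemiAnbd2006, Def. 2.1 p.23] -/
theorem eqToHom_pullbackFunctor_comp_ρ_app :
    (eqToHom (ψ.pullbackFunctor_comp_ρ w) : ψ.pullbackFunctor ⋙ ℋ.ρ w ⟶ _).app A = 𝟙 _ := by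
  rw [eqToHom_app]
  exact eqToHom_refl _ _

omit [αψ.IsEquivalence] in
set_option backward.isDefEq.respectTransparency false in
/-- **The local↔global comparison isomorphism at `A`, read through `α_w` and `e_w`**:
`α_w(ι_A) ≫ e_w⁻¹_{A_u} = ε ≫ (e_ψ⁻¹_A)_w` — the constituents of `Hom.localGlobalIso` collapse by the
triangle identity of `α_w` and `e_w e_w⁻¹ = 1`. [cite: MochizukiSemiAnbd2006, Def. 2.2(i) p.23] -/
theorem map_localGlobalIso_hom_app_comp :
    αw.map ((Hom.localGlobalIso ψ A αψ w P αw eψ ew).hom.app A) ≫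
        ew.inv.app (A.S (ψ.base.vertexMap w)) =
      αw.asEquivalence.counitIso.hom.app ((αψ.obj ((Over.star A).obj A)).S w) ≫
        (eψ.inv.app A).fS w := by
  simp only [Hom.localGlobalIso, Iso.trans_hom, NatTrans.comp_app, Functor.isoWhiskerRight_hom,
    Functor.isoWhiskerLeft_hom, Functor.whiskerRight_app, Functor.whiskerLeft_app, Iso.symm_hom,
    eqToIso.hom, eqToHom_pullbackFunctor_comp_ρ_app, Functor.comp_map,
    CategoryTheory.Functor.map_comp, Category.assoc]
  simp only [Functor.fun_inv_map, Category.assoc]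
  erw [Category.id_comp]
  erw [Equivalence.counitIso_inv_hom_id_app_assoc]
  erw [Equivalence.counitIso_inv_hom_id_app_assoc]
  erw [counitInv_app_comp_map_unitInv_comp]
  erw [Iso.hom_inv_id_app]
  erw [Category.comp_id]
  rfl

set_option backward.isDefEq.respectTransparency false in
/-- **`α_w` of the section of `K_w`**: `α_w(section) ≫ e_w⁻¹_{A_u} = θ ≫ (αψ(diag) ≫ e_ψ⁻¹_A)_w`, where
`θ := α_w(!) ≫ ε` compares the two terminal objects `α_w(K_w 𝟙_A)` and `(αψ 𝟙_A)_w` of `ℋ_w`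
(`K_w(diag) = α_w⁻¹((αψ diag)_w)`, counit naturality, and `map_localGlobalIso_hom_app_comp`).
[cite: MochizukiSemiAnbd2006, Rem. 2.2.1 p.24] -/
theorem map_section_comp :
    αw.map (OverStar.section_ (Over.forgetAdjStar A) (Hom.localGlobalFunctor ψ A αψ w P αw)
        (𝒦.ρ (ψ.base.vertexMap w)) (Hom.localGlobalIso ψ A αψ w P αw eψ ew)
        (Hom.localGlobalFunctor_isTerminal ψ A αψ w P αw)) ≫
      ew.inv.app (A.S (ψ.base.vertexMap w)) =
    (αw.map ((Hom.localGlobalFunctor_isTerminal ψ A αψ w P αw).from (Over.mk (𝟙 P))) ≫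
        αw.asEquivalence.counitIso.hom.app ((αψ.obj (Over.mk (𝟙 A))).S w)) ≫
      (αψ.map (OverStar.diagTop (Over.forgetAdjStar A)) ≫ eψ.inv.app A).fS w := by
  rw [OverStar.section_, CategoryTheory.Functor.map_comp, CategoryTheory.Functor.map_comp,
    Category.assoc, Category.assoc, OverStar.ιHom_eq]
  erw [map_localGlobalIso_hom_app_comp]
  -- `K(diag) = α_w⁻¹((αψ diag)_w)`, then counit naturality
  have hK : (Hom.localGlobalFunctor ψ A αψ w P αw).map (OverStar.diagTop (Over.forgetAdjStar A)) =
      αw.inv.map ((αψ.map (OverStar.diagTop (Over.forgetAdjStar A))).fS w) := rfl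
  rw [hK, Functor.fun_inv_map]
  simp only [Category.assoc, BObj.comp_fS]
  erw [Equivalence.counitIso_inv_hom_id_app_assoc]

/-- The diagonal at `𝟙_A` is the unit at `𝟙_A` (the graph of `𝟙_A`).
[cite: MochizukiSemiAnbd2006, Def. 2.2(i) p.23] -/
theorem diagTop_eq_unit :
    OverStar.diagTop (Over.forgetAdjStar A) = (Over.forgetAdjStar A).unit.app (Over.mk (𝟙 A)) := by
  rw [OverStar.diagTop, OverStar.unit'_eq]
  have h : (Over.star A).map (Over.mk (𝟙 A)).hom = 𝟙 _ := CategoryTheory.Functor.map_id _ _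
  rw [h]
  exact Category.comp_id _

set_option backward.isDefEq.respectTransparency false in
/-- **The section map sends the local base point to the global one** ([SemiAnbd] Rem. 2.2.1: the
vertex `w` IS a component of `A_u`, placed by the global equivalence).  For basepoints `F′` of `ℋ_w`,
`F` of `𝒦_u`, `e : ψ_w^* ⋙ F′ ≅ F`, and the one-point fibres `t` of `F′((αψ 𝟙_A)_w)`, `t′` of
`F′(α_w 𝟙_P)`: `F(σ_w)` carries the LOCAL base point `e(F′(α_w(η_{𝟙_P}) ≫ e_w⁻¹_P)(t′))` (the point of
`range_pi1Map_eq_stabilizer′` for `α_w, e_w`, basepoint `F′`) to the GLOBAL base point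
`(ρ_u ◁ e)((ρ_w ⋙ F′)(αψ(η_{𝟙_A}) ≫ e_ψ⁻¹_A)(t))` (the point of `range_pi1Map_eq_stabilizer′` for
`αψ, e_ψ`, basepoint `ρ_w ⋙ F′`). [cite: MochizukiSemiAnbd2006, Rem. 2.2.1 p.24] -/
theorem map_localGlobalSection_basePoint (F' : ℋ.V w ⥤ FintypeCat.{v₁})
    (F : 𝒦.V (ψ.base.vertexMap w) ⥤ FintypeCat.{v₁}) (e : (ψ.φV w).pullback ⋙ F' ≅ F)
    [Subsingleton (F'.obj ((αψ.obj (Over.mk (𝟙 A))).S w))]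
    (t : (ℋ.ρ w ⋙ F').obj (αψ.obj (Over.mk (𝟙 A)))) (t' : F'.obj (αw.obj (Over.mk (𝟙 P)))) :
    F.map (Hom.localGlobalSection ψ A αψ w P αw eψ ew)
        (e.hom.app P (F'.map (αw.map ((Over.forgetAdjStar P).unit.app (Over.mk (𝟙 P))) ≫
          ew.inv.app P) t')) =
      (show F.obj (A.S (ψ.base.vertexMap w)) from
        (Functor.isoWhiskerLeft (𝒦.ρ (ψ.base.vertexMap w)) e).hom.app A
          ((ℋ.ρ w ⋙ F').map (αψ.map ((Over.forgetAdjStar A).unit.app (Over.mk (𝟙 A))) ≫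
            eψ.inv.app A) t)) := by
  -- (1) naturality of `e` moves everything into `F′`
  have h1 := FunctorToFintypeCat.naturality ((ψ.φV w).pullback ⋙ F') F e.hom
    (Hom.localGlobalSection ψ A αψ w P αw eψ ew)
    (F'.map (αw.map ((Over.forgetAdjStar P).unit.app (Over.mk (𝟙 P))) ≫ ew.inv.app P) t')
  refine h1.symm.trans ?_
  change e.hom.app (A.S (ψ.base.vertexMap w))
      (F'.map ((ψ.φV w).pullback.map (Hom.localGlobalSection ψ A αψ w P αw eψ ew))
        (F'.map (αw.map ((Over.forgetAdjStar P).unit.app (Over.mk (𝟙 P))) ≫ ew.inv.app P) t')) =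
    e.hom.app (A.S (ψ.base.vertexMap w))
      (F'.map ((αψ.map ((Over.forgetAdjStar A).unit.app (Over.mk (𝟙 A))) ≫ eψ.inv.app A).fS w) t)
  congr 1
  -- (2) `α_w(η_{𝟙_P}) ≫ e_w⁻¹_P ≫ ψ_w^*(σ_w) = α_w(section) ≫ e_w⁻¹_{A_u}` (naturality of `e_w⁻¹` and
  -- `section = η_{𝟙_P} ≫ (P × −)(σ_w)`)
  have h2 : (αw.map ((Over.forgetAdjStar P).unit.app (Over.mk (𝟙 P))) ≫ ew.inv.app P) ≫
      (ψ.φV w).pullback.map (Hom.localGlobalSection ψ A αψ w P αw eψ ew) =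
      αw.map (OverStar.section_ (Over.forgetAdjStar A) (Hom.localGlobalFunctor ψ A αψ w P αw)
        (𝒦.ρ (ψ.base.vertexMap w)) (Hom.localGlobalIso ψ A αψ w P αw eψ ew)
        (Hom.localGlobalFunctor_isTerminal ψ A αψ w P αw)) ≫
      ew.inv.app (A.S (ψ.base.vertexMap w)) := by
    rw [Category.assoc]
    erw [← ew.inv.naturality (Hom.localGlobalSection ψ A αψ w P αw eψ ew)]
    rw [← Category.assoc]
    erw [← αw.map_comp]
    congr 2
    rw [Hom.localGlobalSection, OverStar.sectionMap, ← OverStar.unit'_eq]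
    exact (OverStar.eq_unit_comp_map_tr (Over.forgetAdjStar P) _).symm
  have h3 : F'.map ((ψ.φV w).pullback.map (Hom.localGlobalSection ψ A αψ w P αw eψ ew))
      (F'.map (αw.map ((Over.forgetAdjStar P).unit.app (Over.mk (𝟙 P))) ≫ ew.inv.app P) t') =
      F'.map ((αw.map ((Over.forgetAdjStar P).unit.app (Over.mk (𝟙 P))) ≫ ew.inv.app P) ≫
        (ψ.φV w).pullback.map (Hom.localGlobalSection ψ A αψ w P αw eψ ew)) t' := by
    simp only [CategoryTheory.Functor.map_comp, FintypeCat.comp_apply]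
  rw [h3, h2, map_section_comp, diagTop_eq_unit]
  -- (3) the comparison of terminal objects carries `t′` to `t`
  erw [F'.map_comp, FintypeCat.comp_apply]
  congr 1
  exact Subsingleton.elim (α := F'.obj ((αψ.obj (Over.mk (𝟙 A))).S w)) _ _

/-- **(L-σ): vertex alignment makes the section map a monomorphism** ([SemiAnbd] Def. 2.2 (i) p. 23
with Rem. 2.2.1 p. 24).  Let `ψ : ℋ → 𝒦` be VERTEX-ALIGNED (`Hom.IsVertexAligned`), with a GLOBAL
witness (`αψ : B(𝒦)_{/A} ⥲ B(ℋ)`, `e_ψ : ψ^* ≅ (A × −) ⋙ αψ`) and a LOCAL witness at `w ↦ u` on a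
CONNECTED sub-object `P ↪ A_u` (`α_w : (𝒦_u)_{/P} ⥲ ℋ_w`, `e_w : ψ_w^* ≅ (P × −) ⋙ α_w`).  Then the
section map `σ_w : P ⟶ A_u` of abc-iut-w5-d041's global↔local comparison (`Hom.localGlobalSection`)
is a monomorphism.  Proof: choose a basepoint `F′` of `ℋ_w` and `F := ψ_w^* ⋙ F′`; by (D1)
(`range_pi1Map_eq_stabilizer′`, twice) the images `Π′ = ι(Π_ℋ) ⊆ Π_𝒦` and `ι_w(Π_w) ⊆ Π_u` are the
stabilisers of the global base point `a₀ ∈ F(A_u)` and of the local base point `p₀ ∈ F(P)`;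
`F(σ_w)(p₀) = a₀` (`map_localGlobalSection_basePoint`); vertex alignment (a) gives
`Stab_{Π_u}(a₀) = Stab_{Π_u}(p₀)` (`IsVertexAligned.stabilizer_eq_of_ranges`), so `F(σ_w)` is injective
on the transitive `Π_u`-set `F(P)` and `σ_w` is mono (`IsVertexAligned.mono_of_map_eq`).
[cite: MochizukiSemiAnbd2006, Rem. 2.2.1 p.24] -/
theorem IsVertexAligned.localGlobalSection_mono (hva : ψ.IsVertexAligned)
    [PreGaloisCategory.IsConnected P] (m : P ⟶ A.S (ψ.base.vertexMap w)) [Mono m] :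
    Mono (Hom.localGlobalSection ψ A αψ w P αw eψ ew) := by
  -- basepoints: a fibre functor `F′` of `ℋ_w`, `F := ψ_w^* ⋙ F′` with the identity identification
  obtain ⟨F', ⟨hF'⟩⟩ := GaloisCategory.hasFiberFunctor (C := ℋ.V w)
  let F : 𝒦.V (ψ.base.vertexMap w) ⥤ FintypeCat.{v₁} := (ψ.φV w).pullback ⋙ F'
  haveI : FiberFunctor F := fiberFunctor_comp_of_exact _ F'
  let e : (ψ.φV w).pullback ⋙ F' ≅ F := Iso.refl _
  obtain ⟨eT⟩ := nonempty_equiv_fiber_terminal_punit F'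
  -- the one-point fibre of the GLOBAL terminal object `(αψ 𝟙_A)_w`
  haveI : PreservesLimitsOfShape (Discrete PEmpty.{1}) (ℋ.ρ w) := preservesTerminal_ρ ℋ w
  have hTA : IsTerminal ((ℋ.ρ w).obj (αψ.obj (Over.mk (𝟙 A)))) :=
    (Over.mkIdTerminal.isTerminalObj αψ _).isTerminalObj (ℋ.ρ w) _
  let iA : (ℋ.ρ w).obj (αψ.obj (Over.mk (𝟙 A))) ≅ ⊤_ (ℋ.V w) :=
    hTA.uniqueUpToIso terminalIsTerminal
  haveI hsA : Subsingleton (F'.obj ((αψ.obj (Over.mk (𝟙 A))).S w)) :=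
    ((FintypeCat.equivEquivIso.symm (F'.mapIso iA)).trans eT).subsingleton
  haveI : Subsingleton ((ℋ.ρ w ⋙ F').obj (αψ.obj (Over.mk (𝟙 A)))) := hsA
  let t : (ℋ.ρ w ⋙ F').obj (αψ.obj (Over.mk (𝟙 A))) :=
    (FintypeCat.equivEquivIso.symm (F'.mapIso iA)).symm (eT.symm PUnit.unit)
  -- the one-point fibre of the LOCAL terminal object `α_w 𝟙_P`
  have hTP : IsTerminal (αw.obj (Over.mk (𝟙 P))) := Over.mkIdTerminal.isTerminalObj αw _
  let iP : αw.obj (Over.mk (𝟙 P)) ≅ ⊤_ (ℋ.V w) := hTP.uniqueUpToIso terminalIsTerminal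
  haveI hsP : Subsingleton (F'.obj (αw.obj (Over.mk (𝟙 P)))) :=
    ((FintypeCat.equivEquivIso.symm (F'.mapIso iP)).trans eT).subsingleton
  let t' : F'.obj (αw.obj (Over.mk (𝟙 P))) :=
    (FintypeCat.equivEquivIso.symm (F'.mapIso iP)).symm (eT.symm PUnit.unit)
  -- (D1) twice: the images of `Π_ℋ → Π_𝒦` and of `Π_w → Π_u` are the stabilisers of the base points
  haveI : PreservesLimitsOfShape WalkingCospan (ℋ.ρ w) := preservesPullbacks_ρ ℋ w
  haveI : PreservesLimitsOfShape WalkingCospan (ℋ.ρ w ⋙ F') := inferInstance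
  haveI : (ℋ.ρ w ⋙ F').PreservesMonomorphisms := inferInstance
  have ha := range_pi1Map_eq_stabilizer' αψ eψ (ℋ.ρ w ⋙ F')
    (Functor.isoWhiskerLeft (𝒦.ρ (ψ.base.vertexMap w)) e) t
  have hp := range_pi1Map_eq_stabilizer' αw ew F' e t'
  exact hva.mono_of_map_eq w F' F e _ ha m _ hp _
    (map_localGlobalSection_basePoint ψ A αψ eψ w P αw ew F' F e t t')

end Hom

end SemiGraphOfAnabelioids

end Literature.AnabelianGeometry.SemiGraphs
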